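import Summits.HodgeConjecture.CorCM.DihedralSexticPairCurvePowersTransfer
import Summits.HodgeConjecture.CorCM.SexticCMThreefoldPairHodgeOfMarkman
import Summits.HodgeConjecture.CorCM.BiproductSlotsDomination
import HarnessLib

/-!
# COR-CM — the Hodge conjecture for ALL POWERS `E^c × B₀^a × B₁^b` of a sextic CM threefold pair modulo Markman's
# fourfold theorem: intrinsic and geometric forms

Cell `pub-hodgecm2` (COR-CM), seat b30 gen 15 (2026-08-21); COUNT-NEUTRAL; theorems only, no definition, no named fact,
no `sorry`.  Removes the frame from the statement of
`DihedralSexticPairCurvePowers.hodgeConjectureFor_biproduct_comp_of_frame_of_markman`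
(`CorCM/DihedralSexticPairCurvePowersTransfer.lean`), exactly as gen 14 did for ONE copy of each factor
(`CorCM/DihedralSexticPairCurveHodgeOfMarkmanNonGalois.lean`, `…Simple.lean`, `CorCM/SexticCMThreefoldPairHodgeOfMarkman.lean`),
but through ONE conclusion-agnostic lemma:

* §1 **`DihedralSexticPairCurve.exists_frame_realisation_of_not_isGalois`** — for `K = Kf i₁ ⊇ i(k)` sextic CM NOT Galois,
  `k = Kf i₀` imaginary quadratic, realisations `A₃ 0 ⊨ (k; Φ₃ 0)`, `A₃ (m+1) ⊨ (K; Φ₃ (m+1))` with the threefold types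
  not induced from `k` and inequivalent under `{1, c}`: after conjugating the realisation data of the threefold slots
  where necessary (`exists_realisation_conj_succ`, SAME varieties `A₃`), there are `τ`, `δ` (`τ(δ) = i√d`) and a frame
  `e : Hom(K, ℂ) ≃ ℤ/3 × Bool` reading the data as in the frame form (`exists_frame_of_card_fibre_eq_one`);
* §2 `DihedralSexticPairCurvePowers.hodgeConjectureFor_biproduct_comp_of_not_isGalois_of_markman` — intrinsic form
  for every slot map `κ : Fin N → Fin 3`;
* §3 **`SexticCMThreefoldPair.hodgeConjectureFor_biproduct_comp_curveSlots_of_markman`**, **`…_comp_vec_of_markman`**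
  — FINAL FORM: `K` ANY CM field of degree `6`, `k` imaginary quadratic with `i : k →+* K`, `E ⊨ (k; Ψ)` a CM elliptic
  curve, `B₀, B₁ ⊨ (K; Φ_m)` SIMPLE NON-ISOGENOUS abelian threefolds: the Hodge conjecture holds for
  `⨁_j ![E, B₀, B₁] (κ j)` for EVERY `κ : Fin N → Fin 3` — that is for `E^c × B₀^a × B₁^b`, all `a, b, c` — and for
  every abelian variety such a power dominates (every abelian variety isogenous to a product of copies of `E`, `B₀`,
  `B₁`; all their abelian subvarieties and quotients), GIVEN ONLY `Markman2025_weilClasses_algebraic_abelianFourfold`.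
  (Such a pair forces `K` non-Galois with `[K^{gal}:ℚ] = 12`, `SexticCMThreefoldPair.not_isGalois_of_isSimple_of_not_isIsogenous`;
  with all THREE conjugate threefolds `B₀, B₁, B₂` the face class of `Census/DihedralSexticFace.lean` obstructs the method.)
HONEST FRAMING: conditional on Markman's theorem only; `HC_CM` is not asserted.
[cite: Markman2025SurveySecant, Thm. 1.2 and §11.5 Step 2] [cite: Shimura1998, §5.2, §6.1 Cor., §8.2 Prop. 26, §8.4]
[cite: Pohlmann1968, Thm 1] [cite: GaoUllmo2025, Thm 3.1] [cite: Milne2020HodgeClassesAV, Thm. 1]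
[cite: MoonenZarhin1999LowDim, Thm. 0.1] [cite: Lang2002, VI §1]

## References
* [Markman2025SurveySecant] E. Markman, arXiv:2509.23403, Thm. 1.2, §11.5.  [Shimura1998] G. Shimura, *Abelian
  Varieties with Complex Multiplication and Modular Functions*, §5.2, §6.1, §8.2, §8.4.  [Pohlmann1968] Ann. of Math. 88,
  Thm 1.  [GaoUllmo2025] J. Inst. Math. Jussieu 25, Thm 3.1.  [Milne2020HodgeClassesAV] arXiv:2010.08857, Thm. 1.
  [MoonenZarhin1999LowDim] Duke 98 (1999), Thm. 0.1.  [Lang2002] S. Lang, *Algebra*, VI §1.  [MumfordAV1970] §19.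
-/

noncomputable section

open CategoryTheory CategoryTheory.Limits NumberField

/-! ## §1 The normalised frame of a sextic CM threefold pair (conclusion-agnostic) -/

namespace Summit.HodgeConjecture.CorCM.DihedralSexticPairCurve

open Literature.AlgebraicGeometry Literature.AlgebraicGeometry.Motives Literature.AlgebraicGeometry.HodgeTheory
open Literature.AlgebraicGeometry.ComplexMultiplication (IsCMTypeRealisation)

open scoped Classical

variable {I : Type} {Kf : I → Type} [∀ i, Field (Kf i)] [∀ i, NumberField (Kf i)] [∀ i, IsCMField (Kf i)]
  {i₀ i₁ : I}
  {A₃ : Fin 3 → AbelianVariety ℂ} {Φ₃ : ∀ j : Fin 3, CMType (Kf (curveSlots i₀ i₁ j))}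
  {ι₃ : ∀ j, 𝓞 (Kf (curveSlots i₀ i₁ j)) →+* End (A₃ j)}
  {θ₃ : ∀ j, Kf (curveSlots i₀ i₁ j) →+* Module.End ℂ (complexBetti (A₃ j).X 1)}

/-- **Normalising one threefold slot to one member over `τ`.**  If the type of the slot `m+1` is not induced from
`k` (`hprim`), then — keeping the realisation data, or conjugating those of the slot `m+1`
(`exists_realisation_conj_succ`) — one obtains realisation data on the SAME varieties, unchanged at the other slots,
with the type of the slot `m+1` equal to the old one or to its complement, and with exactly ONE member over `τ`.
[cite: Shimura1998, §5.2, §8.4] -/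
theorem exists_realisation_card_fibre_eq_one {i : Kf i₀ →+* Kf i₁} {τ : Kf i₀ →+* ℂ}
    (hττ : ComplexEmbedding.conjugate τ ≠ τ)
    (hdich : ∀ s : Kf i₁ →+* ℂ, s.comp i = τ ∨ s.comp i = ComplexEmbedding.conjugate τ)
    (h6 : Module.finrank ℚ (Kf i₁) = 6) (hA : ∀ j, IsCMTypeRealisation (Φ₃ j) (A₃ j) (ι₃ j) (θ₃ j)) (m : Fin 2)
    (hprim : ∃ s ∈ (Φ₃ m.succ).1, ∃ s' ∈ (Φ₃ m.succ).1, s.comp i ≠ s'.comp i) :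
    ∃ (Φ₃' : ∀ j : Fin 3, CMType (Kf (curveSlots i₀ i₁ j)))
      (ι₃' : ∀ j, 𝓞 (Kf (curveSlots i₀ i₁ j)) →+* End (A₃ j))
      (θ₃' : ∀ j, Kf (curveSlots i₀ i₁ j) →+* Module.End ℂ (complexBetti (A₃ j).X 1)),
      (∀ j, IsCMTypeRealisation (Φ₃' j) (A₃ j) (ι₃' j) (θ₃' j)) ∧ (∀ j, j ≠ m.succ → Φ₃' j = Φ₃ j) ∧
      ((Φ₃' m.succ).1 = (Φ₃ m.succ).1 ∨ (Φ₃' m.succ).1 = (Φ₃ m.succ).1ᶜ) ∧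
      (Finset.univ.filter fun s : Kf i₁ →+* ℂ => s.comp i = τ ∧ s ∈ (Φ₃' m.succ).1).card = 1 := by
  rcases DihedralSexticPair.card_fibre_mem_eq_one_or_two hττ hdich h6 hprim with h1 | ⟨h12, -⟩
  · exact ⟨Φ₃, ι₃, θ₃, hA, fun _ _ => rfl, Or.inl rfl, h1⟩
  · obtain ⟨Φ₃', ι₃', θ₃', hA', hsame, hcompl⟩ := exists_realisation_conj_succ hA m
    exact ⟨Φ₃', ι₃', θ₃', hA', hsame, Or.inr hcompl,
      DihedralSexticPair.card_fibre_mem_eq_one_of_compl hττ hdich h6 (fun s => by rw [hcompl]; exact Iff.rfl) h12⟩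

/-- **THE NORMALISED FRAME (conclusion-agnostic form of gen 14's main theorem).**  Let `k = Kf i₀` be imaginary
quadratic, `K = Kf i₁ ⊇ i(k)` a sextic CM field that is NOT Galois over `ℚ`, and let `A₃ 0 ⊨ (k; Φ₃ 0)`,
`A₃ (m+1) ⊨ (K; Φ₃ (m+1))` be realisations with the threefold types not induced from `k` (`hprim`) and
`Φ₃ 2 ≠ Φ₃ 1, (Φ₃ 1)ᶜ`.  Then there are `τ : k → ℂ` (the member of `Φ₃ 0`), `δ ∈ 𝓞_k` with `δ² = -d < 0` and
`τ(δ) = i√d`, realisation data `(Φ₃', ι₃', θ₃')` on the SAME varieties `A₃` with `Φ₃' 0 = {τ}`, and a frame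
`e : Hom(K, ℂ) ≃ ℤ/3 × Bool` (conjugation flips the sign; sign `true` iff over `τ`; the six sign-preserving elements
of `S₃ × C₂` realised by `Aut(ℂ)`) in which `Φ₃' (m+1)` has sign `true` exactly over the place `m`.
[cite: Lang2002, VI §1 Thm. 1.14] [cite: Shimura1998, §5.2, §8.4, §18.2] -/
theorem exists_frame_realisation_of_not_isGalois
    (h6 : Module.finrank ℚ (Kf i₁) = 6) (h2 : Module.finrank ℚ (Kf i₀) = 2) (i : Kf i₀ →+* Kf i₁)
    (hK : ¬ IsGalois ℚ (Kf i₁)) (hA : ∀ j, IsCMTypeRealisation (Φ₃ j) (A₃ j) (ι₃ j) (θ₃ j))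
    (hprim : ∀ m : Fin 2, ∃ s ∈ (Φ₃ m.succ).1, ∃ s' ∈ (Φ₃ m.succ).1, s.comp i ≠ s'.comp i)
    (hne : (Φ₃ (Fin.succ 0)).1 ≠ (Φ₃ (Fin.succ 1)).1) (hne' : (Φ₃ (Fin.succ 1)).1 ≠ (Φ₃ (Fin.succ 0)).1ᶜ) :
    ∃ (τ : Kf i₀ →+* ℂ) (δ : 𝓞 (Kf i₀)) (d : ℕ)
      (Φ₃' : ∀ j : Fin 3, CMType (Kf (curveSlots i₀ i₁ j)))
      (ι₃' : ∀ j, 𝓞 (Kf (curveSlots i₀ i₁ j)) →+* End (A₃ j))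
      (θ₃' : ∀ j, Kf (curveSlots i₀ i₁ j) →+* Module.End ℂ (complexBetti (A₃ j).X 1))
      (e : (Kf i₁ →+* ℂ) ≃ ZMod 3 × Bool),
      0 < d ∧ ((δ : Kf i₀)) ^ 2 = -(d : Kf i₀) ∧ τ (δ : Kf i₀) = Complex.I * (Real.sqrt d : ℂ) ∧
      (∀ j, IsCMTypeRealisation (Φ₃' j) (A₃ j) (ι₃' j) (θ₃' j)) ∧
      (∀ s : Kf i₁ →+* ℂ, e (ComplexEmbedding.conjugate s) = ((e s).1, !(e s).2)) ∧
      (∀ s : Kf i₁ →+* ℂ, s.comp i = τ ↔ (e s).2 = true) ∧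
      (∀ (j : ZMod 3) (f : Bool), ∃ σ : ℂ ≃+* ℂ, ∀ s : Kf i₁ →+* ℂ,
        e ((σ : ℂ →+* ℂ).comp s) = ((if f then -(e s).1 else (e s).1) + j, (e s).2)) ∧
      (∀ σ : Kf i₀ →+* ℂ, σ ∈ (Φ₃' 0).1 ↔ σ = τ) ∧
      (∀ (m : Fin 2) (s : Kf i₁ →+* ℂ), s ∈ (Φ₃' m.succ).1 ↔ (e s).2 = decide ((e s).1.val = m.val)) := by
  -- `τ :=` the member of the curve's type, `δ` adapted to `τ`
  obtain ⟨τ, hΨ⟩ := QuarticCM.exists_mem_iff_eq_of_quadratic h2 (Φ₃ 0)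
  obtain ⟨δ, d, hd, hδ, hτ⟩ := exists_sq_eq_neg_nat_and_apply_eq h2 τ
  have hττ : ComplexEmbedding.conjugate τ ≠ τ := CMThreefoldPair.conjugate_ne_of_apply_eq hd hτ
  have hdich : ∀ s : Kf i₁ →+* ℂ, s.comp i = τ ∨ s.comp i = ComplexEmbedding.conjugate τ := fun s =>
    DihedralSexticPair.eq_or_eq_conjugate h2 hd hτ (s.comp i)
  -- normalise the slot `1`, then the slot `2`
  obtain ⟨Φ₁, ι₁', θ₁', hA₁, hsame₁, hor₁, hone₁⟩ := exists_realisation_card_fibre_eq_one hττ hdich h6 hA 0 (hprim 0)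
  have h10 : Φ₁ 0 = Φ₃ 0 := hsame₁ 0 (by decide)
  have h12 : Φ₁ (Fin.succ 1) = Φ₃ (Fin.succ 1) := hsame₁ _ (by decide)
  obtain ⟨Φ₂, ι₂', θ₂', hA₂, hsame₂, hor₂, hone₂⟩ :=
    exists_realisation_card_fibre_eq_one hττ hdich h6 hA₁ 1 (by rw [h12]; exact hprim 1)
  have h20 : Φ₂ 0 = Φ₃ 0 := (hsame₂ 0 (by decide)).trans h10
  have h21 : Φ₂ (Fin.succ 0) = Φ₁ (Fin.succ 0) := hsame₂ _ (by decide)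
  rw [h12] at hor₂
  -- the two normalised threefold types are still distinct
  have hne₂ : (Φ₂ (Fin.succ 0)).1 ≠ (Φ₂ (Fin.succ 1)).1 := by
    rw [h21]
    rcases hor₁ with h1 | h1 <;> rcases hor₂ with h2' | h2' <;> rw [h1, h2']
    · exact hne
    · intro h; exact hne' (eq_compl_comm.1 h)
    · exact fun h => hne' h.symm
    · intro h; exact hne (compl_injective h)
  have hone : ∀ m : Fin 2,
      (Finset.univ.filter fun s : Kf i₁ →+* ℂ => s.comp i = τ ∧ s ∈ (Φ₂ m.succ).1).card = 1 :=
    Fin.forall_fin_two.2 ⟨by rw [h21]; exact hone₁, hone₂⟩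
  obtain ⟨e, he_conj, he_sign, he_gal, hΦ⟩ :=
    DihedralSexticPair.exists_frame_of_card_fibre_eq_one hττ hdich hK h6 (Φ := fun m : Fin 2 => Φ₂ m.succ) hone hne₂
  exact ⟨τ, δ, d, Φ₂, ι₂', θ₂', e, hd, hδ, hτ, hA₂, he_conj, he_sign, he_gal, fun σ => by rw [h20]; exact hΨ σ, hΦ⟩

end Summit.HodgeConjecture.CorCM.DihedralSexticPairCurve

/-! ## §2 The intrinsic form for the powers -/

namespace Summit.HodgeConjecture.CorCM.DihedralSexticPairCurvePowers

open Literature.AlgebraicGeometry Literature.AlgebraicGeometry.Motives Literature.AlgebraicGeometry.HodgeTheory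
open Literature.AlgebraicGeometry.ComplexMultiplication (IsCMTypeRealisation)
open Summit.HodgeConjecture.CorCM.DihedralSexticPairCurve (curveSlots exists_frame_realisation_of_not_isGalois)

variable {I : Type} {Kf : I → Type} [∀ i, Field (Kf i)] [∀ i, NumberField (Kf i)] [∀ i, IsCMField (Kf i)]
  {i₀ i₁ : I} {N : ℕ} (κ : Fin N → Fin 3)
  {A₃ : Fin 3 → AbelianVariety ℂ} {Φ₃ : ∀ j : Fin 3, CMType (Kf (curveSlots i₀ i₁ j))}
  {ι₃ : ∀ j, 𝓞 (Kf (curveSlots i₀ i₁ j)) →+* End (A₃ j)}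
  {θ₃ : ∀ j, Kf (curveSlots i₀ i₁ j) →+* Module.End ℂ (complexBetti (A₃ j).X 1)}

/-- **The Hodge conjecture for every power `⨁_j A₃(κ j)` of `E × B₀ × B₁` modulo Markman, intrinsic form**:
`k = Kf i₀` imaginary quadratic, `K = Kf i₁ ⊇ i(k)` sextic CM NOT Galois, `A₃ 0 ⊨ (k; Φ₃ 0)` a CM elliptic curve (any
type), `A₃ (m+1) ⊨ (K; Φ_m)` with types not induced from `k` and `Φ₁ ≠ Φ₀, Φ̄₀` — every rational `(p,p)`-class on
`⨁_j A₃ (κ j)` is algebraic, for every slot map `κ : Fin N → Fin 3` and every `p`, GIVEN ONLY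
`Markman2025_weilClasses_algebraic_abelianFourfold`. [cite: Markman2025SurveySecant, Thm. 1.2 and §11.5 Step 2]
[cite: Pohlmann1968, Thm 1] [cite: GaoUllmo2025, Thm 3.1] [cite: Milne2020HodgeClassesAV, Thm. 1]
[cite: Shimura1998, §8.4] [cite: Lang2002, VI §1] -/
theorem hodgeConjectureFor_biproduct_comp_of_not_isGalois_of_markman
    (hW4 : Markman2025_weilClasses_algebraic_abelianFourfold)
    (h6 : Module.finrank ℚ (Kf i₁) = 6) (h2 : Module.finrank ℚ (Kf i₀) = 2) (i : Kf i₀ →+* Kf i₁)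
    (hK : ¬ IsGalois ℚ (Kf i₁))
    (hA : ∀ j, IsCMTypeRealisation (Φ₃ j) (A₃ j) (ι₃ j) (θ₃ j))
    (hprim : ∀ m : Fin 2, ∃ s ∈ (Φ₃ m.succ).1, ∃ s' ∈ (Φ₃ m.succ).1, s.comp i ≠ s'.comp i)
    (hne : (Φ₃ (Fin.succ 0)).1 ≠ (Φ₃ (Fin.succ 1)).1) (hne' : (Φ₃ (Fin.succ 1)).1 ≠ (Φ₃ (Fin.succ 0)).1ᶜ) :
    HodgeConjectureFor (⨁ fun j => A₃ (κ j)).dim (⨁ fun j => A₃ (κ j)).X := by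
  obtain ⟨τ, δ, d, Φ₃', ι₃', θ₃', e, hd, hδ, hτ, hA', he_conj, he_sign, he_gal, hΨ, hΦ⟩ :=
    exists_frame_realisation_of_not_isGalois h6 h2 i hK hA hprim hne hne'
  exact hodgeConjectureFor_biproduct_comp_of_frame_of_markman κ hW4 h6 h2 i hd hδ hτ hA' e he_conj he_sign he_gal hΨ hΦ

/-- **The Hodge conjecture for every abelian variety dominated by a power `⨁_j A₃(κ j)`**, intrinsic form, modulo
Markman. [cite: Markman2025SurveySecant, Thm. 1.2] [cite: MumfordAV1970, §19] -/
theorem hodgeConjectureFor_of_avDominatedBy_comp_of_not_isGalois_of_markman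
    (hW4 : Markman2025_weilClasses_algebraic_abelianFourfold)
    (h6 : Module.finrank ℚ (Kf i₁) = 6) (h2 : Module.finrank ℚ (Kf i₀) = 2) (i : Kf i₀ →+* Kf i₁)
    (hK : ¬ IsGalois ℚ (Kf i₁))
    (hA : ∀ j, IsCMTypeRealisation (Φ₃ j) (A₃ j) (ι₃ j) (θ₃ j))
    (hprim : ∀ m : Fin 2, ∃ s ∈ (Φ₃ m.succ).1, ∃ s' ∈ (Φ₃ m.succ).1, s.comp i ≠ s'.comp i)
    (hne : (Φ₃ (Fin.succ 0)).1 ≠ (Φ₃ (Fin.succ 1)).1) (hne' : (Φ₃ (Fin.succ 1)).1 ≠ (Φ₃ (Fin.succ 0)).1ᶜ)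
    {B : AbelianVariety ℂ} (hB : Domination.AVDominatedBy B (⨁ fun j => A₃ (κ j))) :
    HodgeConjectureFor B.dim B.X :=
  Domination.hodgeConjectureFor_of_avDominatedBy
    (hodgeConjectureFor_biproduct_comp_of_not_isGalois_of_markman κ hW4 h6 h2 i hK hA hprim hne hne') hB

end Summit.HodgeConjecture.CorCM.DihedralSexticPairCurvePowers

/-! ## §3 The geometric final forms -/

namespace Summit.HodgeConjecture.CorCM.SexticCMThreefoldPair

open Literature.AlgebraicGeometry Literature.AlgebraicGeometry.Motives Literature.AlgebraicGeometry.HodgeTheory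
open Literature.AlgebraicGeometry.ComplexMultiplication (IsCMTypeRealisation)
open Summit.HodgeConjecture.CorCM.DihedralSexticPair (exists_mem_comp_ne_of_isSimple
  cmType_ne_and_ne_compl_of_not_isIsogenous)
open Summit.HodgeConjecture.CorCM.DihedralSexticPairCurve (curveSlots)
open Summit.HodgeConjecture.CorCM.DihedralSexticPairCurvePowers
  (hodgeConjectureFor_biproduct_comp_of_not_isGalois_of_markman)

section Family

variable {I : Type} {Kf : I → Type} [∀ i, Field (Kf i)] [∀ i, NumberField (Kf i)] [∀ i, IsCMField (Kf i)]
  {i₀ i₁ : I} {N : ℕ} (κ : Fin N → Fin 3)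
  {A₃ : Fin 3 → AbelianVariety ℂ} {Φ₃ : ∀ j : Fin 3, CMType (Kf (curveSlots i₀ i₁ j))}
  {ι₃ : ∀ j, 𝓞 (Kf (curveSlots i₀ i₁ j)) →+* End (A₃ j)}
  {θ₃ : ∀ j, Kf (curveSlots i₀ i₁ j) →+* Module.End ℂ (complexBetti (A₃ j).X 1)}

/-- **The Hodge conjecture for every power `⨁_j A₃(κ j)` of `E × B₀ × B₁` modulo Markman, family form**:
`k = Kf i₀` quadratic CM, `K = Kf i₁` sextic CM with `i : k →+* K`, `A₃ 0` a CM elliptic curve of `k`, `A₃ (m+1)`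
SIMPLE CM threefolds of `K`, `A₃ 1 ≁ A₃ 2` — every rational `(p,p)`-class on `⨁_j A₃ (κ j)` is algebraic, for every
`κ : Fin N → Fin 3`, GIVEN ONLY `Markman2025_weilClasses_algebraic_abelianFourfold`.
[cite: Markman2025SurveySecant, Thm. 1.2] [cite: Shimura1998, §6.1 Cor., §8.2 Prop. 26] [cite: Pohlmann1968, Thm 1]
[cite: Milne2020HodgeClassesAV, Thm. 1] -/
theorem hodgeConjectureFor_biproduct_comp_curveSlots_of_markman
    (hW4 : Markman2025_weilClasses_algebraic_abelianFourfold)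
    (h6 : Module.finrank ℚ (Kf i₁) = 6) (h2 : Module.finrank ℚ (Kf i₀) = 2) (i : Kf i₀ →+* Kf i₁)
    (hA : ∀ j, IsCMTypeRealisation (Φ₃ j) (A₃ j) (ι₃ j) (θ₃ j)) (hS : ∀ m : Fin 2, (A₃ m.succ).IsSimple)
    (hni : ¬ AbelianVariety.IsIsogenous (A₃ (Fin.succ 0)) (A₃ (Fin.succ 1))) :
    HodgeConjectureFor (⨁ fun j => A₃ (κ j)).dim (⨁ fun j => A₃ (κ j)).X :=
  have hne := cmType_ne_and_ne_compl_of_not_isIsogenous (hA (Fin.succ 0)) (hA (Fin.succ 1)) hni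
  hodgeConjectureFor_biproduct_comp_of_not_isGalois_of_markman κ hW4 h6 h2 i
    (not_isGalois_of_isSimple_of_not_isIsogenous h6 h2 i (hA (Fin.succ 0)) (hA (Fin.succ 1)) (hS 0) (hS 1) hni)
    hA (fun m => exists_mem_comp_ne_of_isSimple h6 h2 i (hA m.succ) (hS m)) hne.1 hne.2

/-- **The Hodge conjecture for every abelian variety dominated by a power `⨁_j A₃(κ j)` of `E × B₀ × B₁`**, family
form, modulo Markman. [cite: Markman2025SurveySecant, Thm. 1.2] [cite: MumfordAV1970, §19] -/
theorem hodgeConjectureFor_of_avDominatedBy_comp_curveSlots_of_markman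
    (hW4 : Markman2025_weilClasses_algebraic_abelianFourfold)
    (h6 : Module.finrank ℚ (Kf i₁) = 6) (h2 : Module.finrank ℚ (Kf i₀) = 2) (i : Kf i₀ →+* Kf i₁)
    (hA : ∀ j, IsCMTypeRealisation (Φ₃ j) (A₃ j) (ι₃ j) (θ₃ j)) (hS : ∀ m : Fin 2, (A₃ m.succ).IsSimple)
    (hni : ¬ AbelianVariety.IsIsogenous (A₃ (Fin.succ 0)) (A₃ (Fin.succ 1)))
    {B : AbelianVariety ℂ} (hB : Domination.AVDominatedBy B (⨁ fun j => A₃ (κ j))) : HodgeConjectureFor B.dim B.X :=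
  Domination.hodgeConjectureFor_of_avDominatedBy
    (hodgeConjectureFor_biproduct_comp_curveSlots_of_markman κ hW4 h6 h2 i hA hS hni) hB

end Family

section Vec

variable {k K : Type} [Field k] [NumberField k] [IsCMField k] [Field K] [NumberField K] [IsCMField K] {N : ℕ}
  (κ : Fin N → Fin 3)
  {E : AbelianVariety ℂ} {Ψ : CMType k} {ιE : 𝓞 k →+* End E} {θE : k →+* Module.End ℂ (complexBetti E.X 1)}
  {B₀ B₁ : AbelianVariety ℂ} {Φ₀ Φ₁ : CMType K} {ι₀ : 𝓞 K →+* End B₀} {ι₁ : 𝓞 K →+* End B₁}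
  {θ₀ : K →+* Module.End ℂ (complexBetti B₀.X 1)} {θ₁ : K →+* Module.End ℂ (complexBetti B₁.X 1)}

/-- **MAIN THEOREM.  The Hodge conjecture for ALL POWERS `E^c × B₀^a × B₁^b` modulo Markman's fourfold theorem.**
Let `K` be ANY CM field of degree `6`, `k` an imaginary quadratic field with `i : k →+* K`, `E ⊨ (k; Ψ)` a CM elliptic
curve, and `B₀ ⊨ (K; Φ₀)`, `B₁ ⊨ (K; Φ₁)` SIMPLE abelian threefolds that are NOT isogenous.  Then for every slot map
`κ : Fin N → Fin 3` — i.e. for every product `⨁_j ![E, B₀, B₁] (κ j)` of copies of `E`, `B₀`, `B₁` in any number and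
order — every rational `(p,p)`-class on `⨁_j ![E, B₀, B₁] (κ j)` is algebraic, for every `p`, GIVEN ONLY
`Markman2025_weilClasses_algebraic_abelianFourfold`.  Mechanism: Pohlmann's theorem for the CM algebra `∏_j K_{κ j}`;
an `Aut(ℂ)`-balanced weight of the power is a disjoint union of lifts of conjugate pairs, `k`-Weil weights of
`B_m × E` and pair-Weil weights of `B₀ × B₁` (`Census/DihedralSexticPairCurvePowers.lean`, by the sign-defect
equations); those lines are algebraic on `E × B₀ × B₁` by Markman (gen 14) and lift along `κ` by the distribution
lemma (`CorCM/CMWeightDistribution.lean`, André–Milne: CM Hodge classes are pull-backs of Weil classes).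
[cite: Markman2025SurveySecant, Thm. 1.2 and §11.5 Step 2] [cite: Shimura1998, §6.1 Cor., §8.2 Prop. 26, §8.4]
[cite: Pohlmann1968, Thm 1] [cite: GaoUllmo2025, Thm 3.1] [cite: Milne2020HodgeClassesAV, Thm. 1]
[cite: MoonenZarhin1999LowDim, Thm. 0.1] -/
theorem hodgeConjectureFor_biproduct_comp_vec_of_markman (hW4 : Markman2025_weilClasses_algebraic_abelianFourfold)
    (h6 : Module.finrank ℚ K = 6) (h2 : Module.finrank ℚ k = 2) (i : k →+* K)
    (hE : IsCMTypeRealisation Ψ E ιE θE) (hB₀ : IsCMTypeRealisation Φ₀ B₀ ι₀ θ₀)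
    (hB₁ : IsCMTypeRealisation Φ₁ B₁ ι₁ θ₁) (hS₀ : B₀.IsSimple) (hS₁ : B₁.IsSimple)
    (hni : ¬ AbelianVariety.IsIsogenous B₀ B₁) :
    HodgeConjectureFor (⨁ fun j => (![E, B₀, B₁] : Fin 3 → AbelianVariety ℂ) (κ j)).dim
      (⨁ fun j => (![E, B₀, B₁] : Fin 3 → AbelianVariety ℂ) (κ j)).X := by
  -- the family of fields `(k, K)` with its instances (all identifications below are definitional)
  let Kf : Fin 2 → Type := Fin.cons k fun _ : Fin 1 => K
  letI instF : ∀ j, Field (Kf j) := fun j =>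
    Fin.cases (motive := fun j => Field (Kf j)) ‹Field k› (fun _ => ‹Field K›) j
  letI instN : ∀ j, NumberField (Kf j) := fun j =>
    Fin.cases (motive := fun j => NumberField (Kf j)) ‹NumberField k› (fun _ => ‹NumberField K›) j
  haveI instC : ∀ j, IsCMField (Kf j) := fun j =>
    Fin.cases (motive := fun j => IsCMField (Kf j)) ‹IsCMField k› (fun _ => ‹IsCMField K›) j
  -- the two threefolds as families over `Fin 2` (`![E, B₀, B₁] = Fin.cons E ![B₀, B₁]` definitionally)
  let A : Fin 2 → AbelianVariety ℂ := ![B₀, B₁]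
  let Φ : Fin 2 → CMType K := ![Φ₀, Φ₁]
  let ι : ∀ j, 𝓞 K →+* End (A j) := Fin.cons ι₀ (Fin.cons ι₁ finZeroElim)
  let θ : ∀ j, K →+* Module.End ℂ (complexBetti (A j).X 1) := Fin.cons θ₀ (Fin.cons θ₁ finZeroElim)
  have hA : ∀ j, IsCMTypeRealisation (Φ j) (A j) (ι j) (θ j) := Fin.forall_fin_two.2 ⟨hB₀, hB₁⟩
  have hS : ∀ j, (A j).IsSimple := Fin.forall_fin_two.2 ⟨hS₀, hS₁⟩
  exact hodgeConjectureFor_biproduct_comp_curveSlots_of_markman (Kf := Kf) (i₀ := 0) (i₁ := 1)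
    (A₃ := Fin.cons E A) (Φ₃ := Fin.cons Ψ Φ) (ι₃ := Fin.cons ιE ι) (θ₃ := Fin.cons θE θ) κ
    hW4 h6 h2 i (Fin.cases hE hA) hS hni

/-- **The Hodge conjecture for every abelian variety dominated by a product of copies of `E`, `B₀`, `B₁`** (modulo
Markman): every abelian variety isogenous to some `E^c × B₀^a × B₁^b`, every abelian subvariety and every quotient of
such — in particular every abelian variety all of whose simple isogeny factors are among `E`, `B₀`, `B₁`, once
exhibited as dominated by a power. [cite: Markman2025SurveySecant, Thm. 1.2] [cite: MumfordAV1970, §19] -/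
theorem hodgeConjectureFor_of_avDominatedBy_comp_vec_of_markman
    (hW4 : Markman2025_weilClasses_algebraic_abelianFourfold)
    (h6 : Module.finrank ℚ K = 6) (h2 : Module.finrank ℚ k = 2) (i : k →+* K)
    (hE : IsCMTypeRealisation Ψ E ιE θE) (hB₀ : IsCMTypeRealisation Φ₀ B₀ ι₀ θ₀)
    (hB₁ : IsCMTypeRealisation Φ₁ B₁ ι₁ θ₁) (hS₀ : B₀.IsSimple) (hS₁ : B₁.IsSimple)
    (hni : ¬ AbelianVariety.IsIsogenous B₀ B₁)
    {B : AbelianVariety ℂ}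
    (hB : Domination.AVDominatedBy B (⨁ fun j => (![E, B₀, B₁] : Fin 3 → AbelianVariety ℂ) (κ j))) :
    HodgeConjectureFor B.dim B.X :=
  Domination.hodgeConjectureFor_of_avDominatedBy
    (hodgeConjectureFor_biproduct_comp_vec_of_markman κ hW4 h6 h2 i hE hB₀ hB₁ hS₀ hS₁ hni) hB

end Vec

/-! ## §4 Every abelian variety isogenous to a product of copies of `E`, `B₀`, `B₁`, and all its powers -/

section Isogenous

variable {k K : Type} [Field k] [NumberField k] [IsCMField k] [Field K] [NumberField K] [IsCMField K]
  {E : AbelianVariety ℂ} {Ψ : CMType k} {ιE : 𝓞 k →+* End E} {θE : k →+* Module.End ℂ (complexBetti E.X 1)}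
  {B₀ B₁ : AbelianVariety ℂ} {Φ₀ Φ₁ : CMType K} {ι₀ : 𝓞 K →+* End B₀} {ι₁ : 𝓞 K →+* End B₁}
  {θ₀ : K →+* Module.End ℂ (complexBetti B₀.X 1)} {θ₁ : K →+* Module.End ℂ (complexBetti B₁.X 1)}

/-- **The Hodge conjecture for every abelian variety ISOGENOUS TO A PRODUCT OF COPIES of `E`, `B₀`, `B₁`** (indexed by
any finite type `J`, `X ∼ ⨁_{j : J} ![E, B₀, B₁] (cls j)`), modulo Markman's fourfold theorem: re-index `J` by
`Fin |J|` and dominate. [cite: Markman2025SurveySecant, Thm. 1.2] [cite: MumfordAV1970, §19] -/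
theorem hodgeConjectureFor_of_isIsogenous_biproduct_comp_of_markman
    (hW4 : Markman2025_weilClasses_algebraic_abelianFourfold)
    (h6 : Module.finrank ℚ K = 6) (h2 : Module.finrank ℚ k = 2) (i : k →+* K)
    (hE : IsCMTypeRealisation Ψ E ιE θE) (hB₀ : IsCMTypeRealisation Φ₀ B₀ ι₀ θ₀)
    (hB₁ : IsCMTypeRealisation Φ₁ B₁ ι₁ θ₁) (hS₀ : B₀.IsSimple) (hS₁ : B₁.IsSimple)
    (hni : ¬ AbelianVariety.IsIsogenous B₀ B₁)
    {J : Type} [Fintype J] (cls : J → Fin 3) {X : AbelianVariety ℂ}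
    (hX : AbelianVariety.IsIsogenous X (⨁ fun j => (![E, B₀, B₁] : Fin 3 → AbelianVariety ℂ) (cls j))) :
    HodgeConjectureFor X.dim X.X := by
  classical
  let ε : Fin (Fintype.card J) ≃ J := (Fintype.equivFin J).symm
  have e : (⨁ fun j => (![E, B₀, B₁] : Fin 3 → AbelianVariety ℂ) (cls j)) ≅
      ⨁ fun l => (![E, B₀, B₁] : Fin 3 → AbelianVariety ℂ) (cls (ε l)) :=
    (biproduct.reindex ε fun j => (![E, B₀, B₁] : Fin 3 → AbelianVariety ℂ) (cls j)).symm
  exact hodgeConjectureFor_of_avDominatedBy_comp_vec_of_markman (fun l => cls (ε l)) hW4 h6 h2 i hE hB₀ hB₁ hS₀ hS₁ hni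
    (Domination.AVDominatedBy.of_isIsogenous hX ((Domination.AVDominatedBy.refl _).of_iso_right e))

/-- **… and for ALL POWERS of such an abelian variety**: if `X ∼ ⨁_{j : J} ![E, B₀, B₁] (cls j)` then
`HodgeConjectureFor (X^{N+1})` for every `N` (every power is an isogeny factor of a product of copies,
`exists_avDominatedBy_powSucc_biproduct_slots_of_isIsogenous`), modulo Markman — in Hazama's language, `X` is «stably
Hodge» granted Markman's theorem, although `B•(Xⁿ) ≠ D•(Xⁿ)` in general (the `k`-Weil and pair-Weil classes).
[cite: Markman2025SurveySecant, Thm. 1.2] [cite: Gordon1999HodgeAVSurvey, 7.6.1] [cite: MumfordAV1970, §19] -/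
theorem hodgeConjectureFor_powSucc_of_isIsogenous_biproduct_comp_of_markman
    (hW4 : Markman2025_weilClasses_algebraic_abelianFourfold)
    (h6 : Module.finrank ℚ K = 6) (h2 : Module.finrank ℚ k = 2) (i : k →+* K)
    (hE : IsCMTypeRealisation Ψ E ιE θE) (hB₀ : IsCMTypeRealisation Φ₀ B₀ ι₀ θ₀)
    (hB₁ : IsCMTypeRealisation Φ₁ B₁ ι₁ θ₁) (hS₀ : B₀.IsSimple) (hS₁ : B₁.IsSimple)
    (hni : ¬ AbelianVariety.IsIsogenous B₀ B₁)
    {J : Type} [Fintype J] (cls : J → Fin 3) {X : AbelianVariety ℂ}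
    (hX : AbelianVariety.IsIsogenous X (⨁ fun j => (![E, B₀, B₁] : Fin 3 → AbelianVariety ℂ) (cls j))) (N : ℕ) :
    HodgeConjectureFor (X.powSucc N).dim (X.powSucc N).X := by
  obtain ⟨n, ρ, hdom⟩ := exists_avDominatedBy_powSucc_biproduct_slots_of_isIsogenous hX N
  exact hodgeConjectureFor_of_avDominatedBy_comp_vec_of_markman ρ hW4 h6 h2 i hE hB₀ hB₁ hS₀ hS₁ hni hdom

end Isogenous

end Summit.HodgeConjecture.CorCM.SexticCMThreefoldPair

end
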